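import Mathlib
import Summits.QuantumFields.YangMills.Theorems.ColdBoxAllGroupsDefs
import Summits.QuantumFields.YangMills.Theses.LogConcaveChart

/-!
# Crux idea «logconcave-core-extension» — node for ⟨stmt-QuantumFields-24006⟩ `BulkMidWindowSU2`, stubs S6/S7 of LINE-18 v5

Sketch file of the crux-ideate seat `cruxidea-stmt-QuantumFields-24006-2-g0` (typed ≠ proved; nothing here is a
proof of S6/S7, of the crux, or of any Yang–Mills statement).  It types

* `LocalToGlobalSandwich` — the FIRST LEMMA of the line (piece P2): a continuous function whose second differences are
  sandwiched between `(1 − r)·hᵀH₀h` and `(1 + r)·hᵀH₀h` on an open convex neighbourhood `U ⊇ K + B_{H₀}(2ρ)` of a convex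
  set `K` of `H₀`-diameter `≤ ρ` agrees on `K` with a continuous function on ALL of `ℝⁿ` carrying the SAME global sandwich
  (Azagra–Le Gruyer–Mudarra `C^{1,1}_{conv}` jet extension, arXiv:1905.02127 Thm 1.2, applied to `Φ − (1−r)/2·|x|²_{H₀}`,
  whose condition (CW^{1,1}) holds on `K` by the descent lemma inside `U`).  It is exactly the hypothesis shape of the
  LANDED dimension-free comparison `LogConcaveChart.QuadraticCovarianceComparison` (stmt-QuantumFields-26240, proved by
  `Theorems.logConcaveChart_quadraticCovarianceComparison_proof`), which needs the sandwich on all of `ℝⁿ`.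
* `SandwichMeanNearMode` — piece P3b's engine: the crude, dimension-explicit mean–mode gap of a globally sandwiched
  Gibbs measure along one linear functional (`3r·√(n/(1−r))·√(λᵀH₀⁻¹λ)`), used only for CONCENTRATION of the surrogate
  measure on the core (never for the tadpole, whose precision comes from the cubic vertex `1/√β`).
* the two TARGETS of the node, restated by name from the tree (`KernelMeanExpansionG` / `KernelCovExpansionG` at the
  mid window, identical to LINE-18 v5's `KernelMeanExpansionMidG` / `KernelCovExpansionMidG`).
-/

namespace Summit.QuantumFields.YangMills.Cruxes.BulkMidWindowSU2.LogConcaveCoreExtension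

open MeasureTheory Matrix

/-- **P2 — FIRST LEMMA (local-to-global Hessian sandwich, dimension-free).**  For a positive definite `H₀` on `ℝⁿ`,
`0 ≤ r < 1`, a nonempty convex `K` of `H₀`-diameter `≤ ρ`, an open convex `U` containing `K + {v : vᵀH₀v ≤ 4ρ²}`, and a
function `Φ` continuous on `U` whose second differences along segments of `U` lie in `[(1−r)hᵀH₀h, (1+r)hᵀH₀h]`, there is
a continuous `A : ℝⁿ → ℝ` with `A = Φ` on `K` and the same two-sided second-difference sandwich for ALL `x, h`.
(Constants are preserved exactly: `ψ = Φ − (1−r)/2·xᵀH₀x` is convex with `Lip_{H₀}(∇ψ) ≤ 2r` on `U`, satisfies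
(CW^{1,1}) with `M = 2r` on `K` because the descent step stays in `U`, and its Azagra–Le Gruyer–Mudarra extension
`conv(inf_y {ψ y + ⟨∇ψ y, · − y⟩ + r|· − y|²_{H₀}})` is convex with `Lip(∇) ≤ 2r`.)  [ATTACKABLE, Mathlib-only, M–L] -/
def LocalToGlobalSandwich : Prop :=
  ∀ (n : ℕ) (H₀ : Matrix (Fin n) (Fin n) ℝ), H₀.PosDef → ∀ (r ρ : ℝ), 0 ≤ r → r < 1 → 0 ≤ ρ →
    ∀ (K U : Set (Fin n → ℝ)), K.Nonempty → Convex ℝ K → IsOpen U → Convex ℝ U →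
      (∀ x ∈ K, ∀ y ∈ K, (x - y) ⬝ᵥ H₀.mulVec (x - y) ≤ ρ ^ 2) →
      (∀ x ∈ K, ∀ v : Fin n → ℝ, v ⬝ᵥ H₀.mulVec v ≤ 4 * ρ ^ 2 → x + v ∈ U) →
      ∀ (Φ : (Fin n → ℝ) → ℝ), ContinuousOn Φ U →
        (∀ x h : Fin n → ℝ, x + h ∈ U → x - h ∈ U →
            (1 - r) * (h ⬝ᵥ H₀.mulVec h) ≤ Φ (x + h) + Φ (x - h) - 2 * Φ x ∧
              Φ (x + h) + Φ (x - h) - 2 * Φ x ≤ (1 + r) * (h ⬝ᵥ H₀.mulVec h)) →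
        ∃ A : (Fin n → ℝ) → ℝ, Continuous A ∧ (∀ x ∈ K, A x = Φ x) ∧
          ∀ x h : Fin n → ℝ,
            (1 - r) * (h ⬝ᵥ H₀.mulVec h) ≤ A (x + h) + A (x - h) - 2 * A x ∧
              A (x + h) + A (x - h) - 2 * A x ≤ (1 + r) * (h ⬝ᵥ H₀.mulVec h)

/-- **P3b engine (crude mean–mode gap, dimension-explicit).**  For a continuous, globally sandwiched `A` minimised at
`xs`, the Gibbs mean of any linear functional `λ` is within `3r·√(n/(1−r))·√(λᵀH₀⁻¹λ)` of its value at `xs`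
(`∇A − H₀(· − xs)` is `3r`-Lipschitz in the `H₀` geometry, `E_A[∇A] = 0`, and equipartition about the mode
`E_A |x − xs|²_{H₀} ≤ n/(1−r)` from `E⟨x − xs, ∇A⟩ = n`).  Used ONLY to place the surrogate's mean inside the core
(concentration); the constant `3` is not optimised.  [ATTACKABLE, Mathlib-only, M] -/
def SandwichMeanNearMode : Prop :=
  ∀ (n : ℕ) (H₀ : Matrix (Fin n) (Fin n) ℝ), H₀.PosDef → ∀ (r : ℝ), 0 ≤ r → r < 1 →
    ∀ (A : (Fin n → ℝ) → ℝ), Continuous A →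
      (∀ x h : Fin n → ℝ,
          (1 - r) * (h ⬝ᵥ H₀.mulVec h) ≤ A (x + h) + A (x - h) - 2 * A x ∧
            A (x + h) + A (x - h) - 2 * A x ≤ (1 + r) * (h ⬝ᵥ H₀.mulVec h)) →
      ∀ (xs : Fin n → ℝ), (∀ x, A xs ≤ A x) → ∀ (lam : Fin n → ℝ),
        |(∫ x, (lam ⬝ᵥ (x - xs)) * Real.exp (-A x)) / (∫ x, Real.exp (-A x))| ≤
          3 * r * Real.sqrt (n / (1 - r)) * Real.sqrt (lam ⬝ᵥ H₀⁻¹.mulVec lam)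

/-! ## The node's targets (by name from the tree; LINE-18 v5 `KernelMeanExpansionMidG` / `KernelCovExpansionMidG`) -/

open Literature.MathematicalPhysics.QuantumLattice Summit.QuantumFields.YangMills.Theorems.ColdBoxAllGroups in
/-- Target of S6 (verbatim shape of LINE-18 v5's `KernelMeanExpansionMidG`). -/
def TargetS6 : Prop :=
  ∀ θ : ℝ, 0 < θ → θ ≤ 1 / 16 →
    KernelMeanExpansionG (G := Matrix.specialUnitaryGroup (Fin 2) ℂ) (fundamentalRep (Fin 2)) θ (θ / 5)

open Literature.MathematicalPhysics.QuantumLattice Summit.QuantumFields.YangMills.Theorems.ColdBoxAllGroups in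
/-- Target of S7 (verbatim shape of LINE-18 v5's `KernelCovExpansionMidG`). -/
def TargetS7 : Prop :=
  ∀ θ : ℝ, 0 < θ → θ ≤ 1 / 16 →
    KernelCovExpansionG (G := Matrix.specialUnitaryGroup (Fin 2) ℂ) (fundamentalRep (Fin 2)) (θ / 20) θ (θ / 5)

/-- The landed engine the node consumes BY NAME (sanity: the constant exists and is a `Prop`). -/
example : Prop := Summit.QuantumFields.YangMills.Theses.LogConcaveChart.QuadraticCovarianceComparison

/-! ## Toy inhabitants of the hypothesis shapes (ladder rule (N): 0-sorry, ≤ 20 lines each)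

The sandwich hypothesis shape shared by `LocalToGlobalSandwich`, `SandwichMeanNearMode` and the landed
`QuadraticCovarianceComparison` is inhabited non-vacuously: in dimension `1` with `H₀ = 1` the potential `Φ x = ½·x₀²`
satisfies it with `r = 0` (and every `r ≥ 0`), and `0` is a minimiser (the shape `∀ x, A xs ≤ A x`).  Non-rigidity (the
shape does not force `Φ` to be quadratic): `x²/2 + (r/2)·cos x` has second differences in `[(1−r)h², (1+r)h²]`; not
re-proved here. -/
section Toys

private theorem secondDiff_half_sq (x h : Fin 1 → ℝ) :
    (fun y : Fin 1 → ℝ => (1 / 2 : ℝ) * y 0 ^ 2) (x + h) + (fun y : Fin 1 → ℝ => (1 / 2 : ℝ) * y 0 ^ 2) (x - h)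
      - 2 * (fun y : Fin 1 → ℝ => (1 / 2 : ℝ) * y 0 ^ 2) x = h ⬝ᵥ (1 : Matrix (Fin 1) (Fin 1) ℝ).mulVec h := by
  simp [dotProduct, Matrix.one_mulVec]
  ring

/-- The two-sided second-difference sandwich (any `r ≥ 0`) is inhabited by `Φ x = ½ x₀²`, `H₀ = 1`, `n = 1`. -/
example (r : ℝ) (hr : 0 ≤ r) : ∀ x h : Fin 1 → ℝ,
    (1 - r) * (h ⬝ᵥ (1 : Matrix (Fin 1) (Fin 1) ℝ).mulVec h) ≤
        (fun y : Fin 1 → ℝ => (1 / 2 : ℝ) * y 0 ^ 2) (x + h) + (fun y : Fin 1 → ℝ => (1 / 2 : ℝ) * y 0 ^ 2) (x - h)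
          - 2 * (fun y : Fin 1 → ℝ => (1 / 2 : ℝ) * y 0 ^ 2) x ∧
      (fun y : Fin 1 → ℝ => (1 / 2 : ℝ) * y 0 ^ 2) (x + h) + (fun y : Fin 1 → ℝ => (1 / 2 : ℝ) * y 0 ^ 2) (x - h)
          - 2 * (fun y : Fin 1 → ℝ => (1 / 2 : ℝ) * y 0 ^ 2) x ≤
        (1 + r) * (h ⬝ᵥ (1 : Matrix (Fin 1) (Fin 1) ℝ).mulVec h) := by
  intro x h
  rw [secondDiff_half_sq]
  have h0 : 0 ≤ h ⬝ᵥ (1 : Matrix (Fin 1) (Fin 1) ℝ).mulVec h := by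
    simp [dotProduct, Matrix.one_mulVec, mul_self_nonneg]
  constructor <;> nlinarith

/-- The minimiser shape `∀ x, A xs ≤ A x` of `SandwichMeanNearMode` is inhabited (`xs = 0`). -/
example : ∀ x : Fin 1 → ℝ,
    (fun y : Fin 1 → ℝ => (1 / 2 : ℝ) * y 0 ^ 2) 0 ≤ (fun y : Fin 1 → ℝ => (1 / 2 : ℝ) * y 0 ^ 2) x := by
  intro x
  show (1 / 2 : ℝ) * (0 : Fin 1 → ℝ) 0 ^ 2 ≤ (1 / 2 : ℝ) * x 0 ^ 2
  simp only [Pi.zero_apply]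
  nlinarith [sq_nonneg (x 0)]

/-- `H₀ = 1` is positive definite (the `H₀.PosDef` binder is inhabited). -/
example : (1 : Matrix (Fin 1) (Fin 1) ℝ).PosDef := Matrix.PosDef.one

end Toys

end Summit.QuantumFields.YangMills.Cruxes.BulkMidWindowSU2.LogConcaveCoreExtension
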